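import Summits.AtomisticToContinuum.HydrodynamicLimit.Theses.JaynesSqueeze
import Summits.AtomisticToContinuum.HydrodynamicLimit.Theorems.JaynesSqueezeBlockGibbsToRelEntropyCore
import Summits.AtomisticToContinuum.HydrodynamicLimit.Theorems.JaynesSqueezeSqueezeToBlockGibbs
import Summits.AtomisticToContinuum.HydrodynamicLimit.Theorems.JaynesSqueezeEntropicWeakStrongHS
import Summits.AtomisticToContinuum.HydrodynamicLimit.Theorems.JaynesSqueezeLocalGibbsConcentrationDilute
import Summits.AtomisticToContinuum.HydrodynamicLimit.Theorems.JaynesSqueezeHardSphereLDA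
import HarnessLib

/-!
# Birth skeleton for the crux `SqueezeClosure` (stmt-AtomisticToContinuum-16266, route `JaynesSqueeze`)

Crux (rank 7, the route's only non-dynamical crux):
`SqueezeClosure := NoMeanEntropyProduction → CollisionalFluxLocality → EnergyCurrentTails →
MeanBlocksInRange → DiluteSelfConsistency → RelEntropyVanishing` — the five dynamical cruxes
K1 (no mean entropy production), K2 (collisional flux locality), K4 (cubic energy-current tails),
R (mean blocks in range), D (dilute self-consistency) imply Yau's relative-entropy target (0766).

## State of the tree (2026-08-17) — what is NOT a stub any more

* the squeeze `SqueezeToBlockGibbs` (13463) is PROVED (`Theorems.JaynesSqueezeSqueeze.squeezeToBlockGibbs_proof`);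
* the statics `HsEosLowDensity` (0768), `HardSphereLDA` (13459), `LocalGibbsConcentrationDilute` (13460) and
  Dafermos' stability `EntropicWeakStrongHS` (13461) are PROVED;
* the bookkeeping at the Euler-driven reference is PROVED: `Theorems.JaynesSqueezeClosure.
  blockGibbsToRelEntropy_of_meanFieldsConverge : MeanFieldsConverge → BlockGibbsToRelEntropy` (p112588),
  `MeanFieldsConverge` = convergence of the MEAN empirical density / momentum / energy fields of `Φ_t z`
  to the Euler fields at every `t < T` (the def below is that hypothesis verbatim).

So the open content of the crux is exactly `K2 + K4 + R + D + BlockGibbs ⟹ MeanFieldsConverge`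
("MeanFieldsFromBlockGibbs", memo v3 of prover-pitem-13464), cut here into FIVE named stubs:

* S0 `stub_matchedSqueeze` (M, provable now) — the squeeze with its block-MATCHED reference retained:
  `K1 → R → D → MatchedBlockGibbs`, the reference activity being `r e^{g_σ(r)}` at the block density
  `r = m³·mass` of the one-body intensity measure, velocity/temperature the block mean velocity / kinetic
  temperature (the witness built inside `JaynesSqueezeSqueeze.blockGibbs_core`, whose conclusion is only
  existential; the typed waypoint `BlockGibbs` forgets the matching and the dilute packing of the
  reference, which the kinetic closure needs for the static concentration tools).
* S1 `stub_kineticClosure` (M–L) — `MatchedBlockGibbs → K4 → R → D → KineticClosure`: block local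
  Gibbsianity in specific relative entropy + exponential concentration of one-body block observables under
  the (dilute, block-constant) reference + the entropy inequality + uniform integrability (K4) give the MEAN
  kinetic momentum flux `E[(N+1)⁻¹Σᵢ (vᵢ·∇χ(xᵢ)) vᵢʲ]` and kinetic energy flux `E[(N+1)⁻¹Σᵢ (vᵢ·∇χ(xᵢ))|vᵢ|²/2]`
  as the local-Maxwellian moments `Σ_B ρ_B[(u_B·∇χ)u_Bʲ + θ_B ∂ⱼχ]`, `Σ_B ρ_B (|u_B|²/2 + 5θ_B/2) u_B·∇χ` of the
  block mean fields, uniformly in `s ≤ t`, eventually in `N` (the kinetic parts K2 explicitly leaves out).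
* S2 `stub_blockClausius` (M, provable now) — `R → D → BlockClausius`: the FREE (Clausius) direction of K1,
  `𝒮^m_N(s) ≥ 𝒮[U(s)] − δ = 𝒮[U₀] − δ` eventually, uniformly in `s ≤ t`: non-negativity of the relative
  entropy in the finite-`N` bookkeeping identity at the matched reference + uniform LDA (R) + the time-zero
  identification + entropy conservation of the classical solution (all landed as parts I–VIII of the squeeze).
  It is the entropy hypothesis `∫ h_σ(V_N(s)) ≤ ∫ h_σ(U(0)) + δ` of Dafermos' stability for the block fields.
* S3 `stub_entropicWeakStrongL1` (M–L) — Dafermos' a-priori stability with the weak-form residual assumed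
  small only AT the evaluation time `s` and in `L¹(0, s)` (instead of `sup_{[0,t]}`): same relative-entropy
  computation as the landed `EntropicWeakStrongHS`, closed by Gronwall WITH FORCING,
  `ℰ(s) ≤ |W(s)| + a + C e^{Cs}(a s + ∫₀ˢ |W|)`. Strictly stronger than the proved item (not derivable from it
  as typed); needed because K2 is typed at a FIXED endpoint (its `∀ᶠ N` depends on the endpoint), so the
  block fields' residual `W_N(s) → 0` only pointwise in `s` (and boundedly), never uniformly — the one
  non-uniform quantifier recorded on stmt-13464 (memo v3 §2).
* S4 `stub_meanFieldsSynthesis` (L, the hardest) — `KineticClosure → BlockClausius → K2 → K4 → R → D →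
  BlockGibbs → EntropicWeakStrongL1 → MeanFieldsConverge`: comparison field `V_{N,m}(s)` = block mean
  conservative fields of the intensity measure (jointly measurable by `HardSphereFlow.measurable_flow_prod_torus`,
  `K`-valued by R, Clausius by S2, `V_{N,m}(0) → U(0)` from the tie); weak form against the entropy variables
  `λ^E = Dh_σ(U)` with the test function FROZEN on the intervals of a finite time grid (K2 at the finitely many
  grid endpoints, S1 for the streaming terms, block-averaging errors `O(1/m)`), the time-integrated K2
  residuals handled POINTWISE in `τ` by dominated convergence (bounded by energy conservation), then S3 at
  each fixed `s` and a diagonal `m → ∞`; mean fields from `‖V_{N,m}(s) − U(s)‖_{L²} → 0` and `O(1/m)` oscillation.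
  This realises the closure without restating K2 uniformly in the endpoint and without a time-mollified
  comparison field (cf. TWO-LAYER PLAN of the route header: both were the foreseen alternatives).

Composition `SqueezeClosure_of` (sorry-free): S0 gives the matched reference from K1, R, D; S1/S2 the
kinetic closure and the Clausius bound; S4 (with K2, the PROVED `BlockGibbs` from the landed squeeze and S3)
gives `MeanFieldsConverge`; the landed `blockGibbsToRelEntropy_of_meanFieldsConverge` chain and the proved
statics give `RelEntropyVanishing`.

Disproof used: none (no `Disproof.lean` on this crux yet, `ledger crux ls` 2026-08-17). Negatives index:
9168 (junk-EOS refutation of an untied, unguarded one-body entropy statement) — every new statement below is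
tied to the data at `t = 0` and carries the dilute packing guard of K1/R; the EOS is only evaluated at block
densities in `[inf ρ/2, 2 sup ρ]` with `ρσ³ ≤ ηc`.
-/

noncomputable section

namespace Summit.AtomisticToContinuum.HydrodynamicLimit.Cruxes.SqueezeClosure.Birth

open scoped BigOperators Topology ENNReal
open MeasureTheory Filter Set
open Literature.MathematicalPhysics.KineticTheory Literature.Analysis.FluidPDE Literature.Analysis.FunctionSpaces
open Summit.AtomisticToContinuum.HydrodynamicLimit.Theses.JaynesSqueeze

/-! ## §0 The typed waypoints of the line -/

/-- **MeanFieldsConverge** — verbatim the hypothesis `hMFC` of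
`Theorems.JaynesSqueezeClosure.blockGibbsToRelEntropy_of_meanFieldsConverge`: for continuous positive profiles,
below some `σ₀`, along every classical hard-sphere-Euler solution tied at `t = 0` to the local Gibbs laws through
a flow family, at every `t ∈ [0, T)` the MEAN empirical density / momentum / energy fields of `Φ_t z` tested
against continuous `χ` converge to the Euler fields. -/
def MeanFieldsConverge : Prop :=
  ∀ (a₀ θ₀ : T3 → ℝ) (u₀ : T3 → V3), Continuous a₀ → Continuous θ₀ → Continuous u₀ →
      (∀ x, 0 < a₀ x) → (∀ x, 0 < θ₀ x) → ∃ σ₀ : ℝ, 0 < σ₀ ∧ ∀ σ : ℝ, 0 < σ → σ < σ₀ →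
      ∀ (T : ℝ) (ρ θ : ℝ → T3 → ℝ) (u : ℝ → T3 → V3), IsHardSphereEulerSolution σ T ρ u θ →
      ∀ Φ : (N : ℕ) → HardSphereFlow (Torus.geometry (Fin 3)) (hsDiameter σ N) (N + 1),
      TendstoHydroFieldsAt (fun N => localGibbsLaw σ a₀ u₀ θ₀ N (Φ N)) Φ ρ u θ 0 →
      ∀ t ∈ Set.Ico 0 T,
        (∀ χ : T3 → ℝ, Continuous χ → Tendsto (fun N : ℕ => ∫ z, empiricalDensityField ((Φ N).flow t z) χ
          ∂(localGibbsLaw σ a₀ u₀ θ₀ N (Φ N))) atTop (𝓝 (∫ x, χ x * ρ t x))) ∧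
        (∀ χ : T3 → ℝ, Continuous χ → ∀ j : Fin 3,
          Tendsto (fun N : ℕ => ∫ z, empiricalMomentumField ((Φ N).flow t z) χ j
            ∂(localGibbsLaw σ a₀ u₀ θ₀ N (Φ N))) atTop (𝓝 (∫ x, χ x * (ρ t x • u t x) j))) ∧
        (∀ χ : T3 → ℝ, Continuous χ → Tendsto (fun N : ℕ => ∫ z, empiricalEnergyField ((Φ N).flow t z) χ
          ∂(localGibbsLaw σ a₀ u₀ θ₀ N (Φ N))) atTop
            (𝓝 (∫ x, χ x * totalEnergyDensity (ρ t x) (u t x) (θ t x))))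

/-- **MatchedBlockGibbs** — block local Gibbsianity in specific relative entropy at the block-MATCHED
reference (Csiszár I-projection up to the static approximation): under the hypotheses of K1 (tie at `t = 0`,
`t < T`, packing `ρ_s σ³ ≤ ηc` on `[0, t]`), for every `δ > 0`, for `m ≥ m₀`, eventually in `N`, for all
`s ≤ t`: `KL(lawAt Φ_N P_N s ‖ localGibbsLaw σ (r e^{g_σ(r)}) vel temp) ≤ δ (N+1)` where, block by block at
scale `1/m`, `r = m³ · mass`, `vel`, `temp` are the density, mean velocity and kinetic temperature of the
one-body intensity measure of the law at time `s`, and `g_σ(r) = f_ex(rσ³) + rσ³ f_ex'(rσ³)`. Implies the typed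
waypoint `BlockGibbs` (with the ranges of R); it is what `JaynesSqueezeSqueeze.blockGibbs_core` constructs. -/
def MatchedBlockGibbs : Prop :=
  ∀ (a₀ θ₀ : (UnitAddTorus (Fin 3)) → ℝ) (u₀ : (UnitAddTorus (Fin 3)) → (EuclideanSpace ℝ (Fin 3))), Continuous a₀ →
    Continuous θ₀ → Continuous u₀ → (∀ x, 0 < a₀ x) → (∀ x, 0 < θ₀ x) →
    ∃ σ₀ : ℝ, 0 < σ₀ ∧ ∃ ηc : ℝ, 0 < ηc ∧ ∀ σ : ℝ, 0 < σ → σ < σ₀ → ∀ (T : ℝ) (ρ θ : ℝ → (UnitAddTorus (Fin 3)) →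
    ℝ) (u : ℝ → (UnitAddTorus (Fin 3)) →
    (EuclideanSpace ℝ (Fin 3))), Literature.MathematicalPhysics.KineticTheory.IsHardSphereEulerSolution σ T ρ u θ →
    ∀ Φ : (N : ℕ) →
    Literature.Analysis.FluidPDE.HardSphereFlow (Literature.Analysis.FluidPDE.Torus.geometry (Fin 3)) (Literature.MathematicalPhysics.KineticTheory.hsDiameter σ N) (N + 1), Literature.MathematicalPhysics.KineticTheory.TendstoHydroFieldsAt (fun N => Literature.MathematicalPhysics.KineticTheory.localGibbsLaw σ a₀ u₀ θ₀ N (Φ N)) Φ ρ u θ 0 →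
    ∀ t ∈ Set.Ico 0 T, (∀ s ∈ Set.Icc 0 t, ∀ x, ρ s x * σ ^ 3 ≤ ηc) →
    let P : (N : ℕ) → MeasureTheory.Measure (Literature.Analysis.FluidPDE.Config (N + 1) (Fin 3) (UnitAddTorus (Fin 3))) := fun N => Literature.MathematicalPhysics.KineticTheory.localGibbsLaw σ a₀ u₀ θ₀ N (Φ N);
    let μ : (N : ℕ) → ℝ → MeasureTheory.Measure ((UnitAddTorus (Fin 3)) × (EuclideanSpace ℝ (Fin 3))) := fun N s => ((N : ENNReal) + 1)⁻¹ • MeasureTheory.Measure.sum (fun i : Fin (N + 1) => ((Φ N).lawAt (P N) s).map (fun z => z i));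
    let idx : ℕ → (UnitAddTorus (Fin 3)) → (Fin 3 → ℕ) := fun m x i => ⌊(m : ℝ) * Literature.Analysis.FunctionSpaces.Torus.repr x i⌋₊;
    let μB : ℕ → ℝ → ℕ → (Fin 3 → ℕ) → MeasureTheory.Measure (EuclideanSpace ℝ (Fin 3)) := fun N s m k => ((μ N s).restrict ({x : (UnitAddTorus (Fin 3)) | idx m x = k} ×ˢ (Set.univ : Set (EuclideanSpace ℝ (Fin 3))))).snd;
    let mass : ℕ → ℝ → ℕ → (Fin 3 → ℕ) → ℝ := fun N s m k => ((μB N s m k) Set.univ).toReal;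
    let vel : ℕ → ℝ → ℕ → (Fin 3 → ℕ) → (EuclideanSpace ℝ (Fin 3)) := fun N s m k => (mass N s m k)⁻¹ • ∫ v, v ∂(μB N s m k);
    let temp : ℕ → ℝ → ℕ → (Fin 3 → ℕ) → ℝ := fun N s m k => (3 * mass N s m k)⁻¹ * ∫ v, ‖v - vel N s m k‖ ^ 2 ∂(μB N s m k);
    let g : ℝ → ℝ := fun r => Literature.MathematicalPhysics.KineticTheory.hsExcessFreeEnergy (r * σ ^ 3) + r * σ ^ 3 * deriv Literature.MathematicalPhysics.KineticTheory.hsExcessFreeEnergy (r * σ ^ 3);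
    ∀ δ : ℝ, 0 < δ → ∃ m₀ : ℕ, ∀ m : ℕ, m₀ ≤ m →
      ∀ᶠ N : ℕ in Filter.atTop, ∀ s ∈ Set.Icc 0 t, InformationTheory.klDiv ((Φ N).lawAt (P N) s) (Literature.MathematicalPhysics.KineticTheory.localGibbsLaw σ (fun x => (m : ℝ) ^ 3 * mass N s m (idx m x) * Real.exp (g ((m : ℝ) ^ 3 * mass N s m (idx m x)))) (fun x => vel N s m (idx m x)) (fun x => temp N s m (idx m x)) N (Φ N)) ≤ ENNReal.ofReal (δ * ((N : ℝ) + 1))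

/-- **KineticClosure** — the kinetic (streaming) parts of the momentum and energy fluxes close on the block
mean fields: under the hypotheses of K1 and for every smooth `χ`, for all `ε > 0`, for `m ≥ m₀`, eventually
in `N`, for all `s ≤ t`:
`|E[(N+1)⁻¹ Σᵢ (vᵢ·∇χ(xᵢ)) vᵢʲ] − Σ_k m³ mass_k (Σ_l vel_{k,l} vel_{k,j} gI_{k,l} + temp_k gI_{k,j})| ≤ ε` (all `j`)
and `|E[(N+1)⁻¹ Σᵢ (vᵢ·∇χ(xᵢ)) |vᵢ|²/2] − Σ_k m³ mass_k (|vel_k|²/2 + 5 temp_k/2) Σ_l vel_{k,l} gI_{k,l}| ≤ ε`,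
`gI_{k,l} = ∫_{B_k} ∂_l χ` (the local-Maxwellian second and contracted third moments; `Ekin`, `Ekin3`, `w`,
`gI`, `mass`, `vel`, `temp` exactly as in `CollisionalFluxLocality`). -/
def KineticClosure : Prop :=
  ∀ (a₀ θ₀ : (UnitAddTorus (Fin 3)) → ℝ) (u₀ : (UnitAddTorus (Fin 3)) → (EuclideanSpace ℝ (Fin 3))), Continuous a₀ →
    Continuous θ₀ → Continuous u₀ → (∀ x, 0 < a₀ x) → (∀ x, 0 < θ₀ x) →
    ∃ σ₀ : ℝ, 0 < σ₀ ∧ ∃ ηc : ℝ, 0 < ηc ∧ ∀ σ : ℝ, 0 < σ → σ < σ₀ → ∀ (T : ℝ) (ρ θ : ℝ → (UnitAddTorus (Fin 3)) →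
    ℝ) (u : ℝ → (UnitAddTorus (Fin 3)) →
    (EuclideanSpace ℝ (Fin 3))), Literature.MathematicalPhysics.KineticTheory.IsHardSphereEulerSolution σ T ρ u θ →
    ∀ Φ : (N : ℕ) →
    Literature.Analysis.FluidPDE.HardSphereFlow (Literature.Analysis.FluidPDE.Torus.geometry (Fin 3)) (Literature.MathematicalPhysics.KineticTheory.hsDiameter σ N) (N + 1), Literature.MathematicalPhysics.KineticTheory.TendstoHydroFieldsAt (fun N => Literature.MathematicalPhysics.KineticTheory.localGibbsLaw σ a₀ u₀ θ₀ N (Φ N)) Φ ρ u θ 0 →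
    ∀ t ∈ Set.Ico 0 T, (∀ s ∈ Set.Icc 0 t, ∀ x, ρ s x * σ ^ 3 ≤ ηc) → ∀ χ : (UnitAddTorus (Fin 3)) →
    ℝ, Literature.Analysis.FunctionSpaces.Torus.IsSmooth χ →
    let P : (N : ℕ) → MeasureTheory.Measure (Literature.Analysis.FluidPDE.Config (N + 1) (Fin 3) (UnitAddTorus (Fin 3))) := fun N => Literature.MathematicalPhysics.KineticTheory.localGibbsLaw σ a₀ u₀ θ₀ N (Φ N);
    let μ : (N : ℕ) → ℝ → MeasureTheory.Measure ((UnitAddTorus (Fin 3)) × (EuclideanSpace ℝ (Fin 3))) := fun N s => ((N : ENNReal) + 1)⁻¹ • MeasureTheory.Measure.sum (fun i : Fin (N + 1) => ((Φ N).lawAt (P N) s).map (fun z => z i));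
    let idx : ℕ → (UnitAddTorus (Fin 3)) → (Fin 3 → ℕ) := fun m x i => ⌊(m : ℝ) * Literature.Analysis.FunctionSpaces.Torus.repr x i⌋₊;
    let μB : ℕ → ℝ → ℕ → (Fin 3 → ℕ) → MeasureTheory.Measure (EuclideanSpace ℝ (Fin 3)) := fun N s m k => ((μ N s).restrict ({x : (UnitAddTorus (Fin 3)) | idx m x = k} ×ˢ (Set.univ : Set (EuclideanSpace ℝ (Fin 3))))).snd;
    let mass : ℕ → ℝ → ℕ → (Fin 3 → ℕ) → ℝ := fun N s m k => ((μB N s m k) Set.univ).toReal;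
    let vel : ℕ → ℝ → ℕ → (Fin 3 → ℕ) → (EuclideanSpace ℝ (Fin 3)) := fun N s m k => (mass N s m k)⁻¹ • ∫ v, v ∂(μB N s m k);
    let temp : ℕ → ℝ → ℕ → (Fin 3 → ℕ) → ℝ := fun N s m k => (3 * mass N s m k)⁻¹ * ∫ v, ‖v - vel N s m k‖ ^ 2 ∂(μB N s m k);
    let w : (UnitAddTorus (Fin 3)) × (EuclideanSpace ℝ (Fin 3)) → ℝ := fun y => ∑ l : Fin 3, y.2 l * Literature.Analysis.FunctionSpaces.Torus.partialDeriv l χ y.1;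
    let gI : ℕ → (Fin 3 → ℕ) → Fin 3 → ℝ := fun m k j => ∫ x in {x : (UnitAddTorus (Fin 3)) | idx m x = k}, Literature.Analysis.FunctionSpaces.Torus.partialDeriv j χ x;
    let Ekin : ℕ → ℝ → Fin 3 → ℝ := fun N s j => ∫ z, ((N : ℝ) + 1)⁻¹ * ∑ i : Fin (N + 1), w ((Φ N).flow s z i) * ((Φ N).flow s z i).2 j ∂(P N);
    let Ekin3 : ℕ → ℝ → ℝ := fun N s => ∫ z, ((N : ℝ) + 1)⁻¹ * ∑ i : Fin (N + 1), w ((Φ N).flow s z i) * (‖((Φ N).flow s z i).2‖ ^ 2 / 2) ∂(P N);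
    let Kmom : ℕ → ℝ → ℕ → Fin 3 → ℝ := fun N s m j => ∑ k ∈ Fintype.piFinset (fun _ : Fin 3 => Finset.range m), (m : ℝ) ^ 3 * mass N s m k * ((∑ l : Fin 3, vel N s m k l * vel N s m k j * gI m k l) + temp N s m k * gI m k j);
    let Ken : ℕ → ℝ → ℕ → ℝ := fun N s m => ∑ k ∈ Fintype.piFinset (fun _ : Fin 3 => Finset.range m), (m : ℝ) ^ 3 * mass N s m k * (‖vel N s m k‖ ^ 2 / 2 + 5 / 2 * temp N s m k) * ∑ l : Fin 3, vel N s m k l * gI m k l;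
    ∀ ε : ℝ, 0 < ε → ∃ m₀ : ℕ, ∀ m : ℕ, m₀ ≤ m →
      ∀ᶠ N : ℕ in Filter.atTop, ∀ s ∈ Set.Icc 0 t, (∀ j : Fin 3, |Ekin N s j - Kmom N s m j| ≤ ε) ∧ |Ekin3 N s - Ken N s m| ≤ ε

/-- **BlockClausius** — the free (second-law) direction of K1: under the hypotheses of K1, for all `δ > 0`,
for `m ≥ m₀`, eventually in `N`, for all `s ≤ t`: `𝒮^m_N(s) ≥ ∫ ρ_s s_σ(ρ_s, θ_s) dx − δ` (same `Sblk`,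
`ent` as K1; by entropy conservation of the classical solution the right side is `𝒮[U₀] − δ`). -/
def BlockClausius : Prop :=
  ∀ (a₀ θ₀ : (UnitAddTorus (Fin 3)) → ℝ) (u₀ : (UnitAddTorus (Fin 3)) → (EuclideanSpace ℝ (Fin 3))), Continuous a₀ →
    Continuous θ₀ → Continuous u₀ → (∀ x, 0 < a₀ x) → (∀ x, 0 < θ₀ x) →
    ∃ σ₀ : ℝ, 0 < σ₀ ∧ ∃ ηc : ℝ, 0 < ηc ∧ ∀ σ : ℝ, 0 < σ → σ < σ₀ → ∀ (T : ℝ) (ρ θ : ℝ → (UnitAddTorus (Fin 3)) →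
    ℝ) (u : ℝ → (UnitAddTorus (Fin 3)) →
    (EuclideanSpace ℝ (Fin 3))), Literature.MathematicalPhysics.KineticTheory.IsHardSphereEulerSolution σ T ρ u θ →
    ∀ Φ : (N : ℕ) →
    Literature.Analysis.FluidPDE.HardSphereFlow (Literature.Analysis.FluidPDE.Torus.geometry (Fin 3)) (Literature.MathematicalPhysics.KineticTheory.hsDiameter σ N) (N + 1), Literature.MathematicalPhysics.KineticTheory.TendstoHydroFieldsAt (fun N => Literature.MathematicalPhysics.KineticTheory.localGibbsLaw σ a₀ u₀ θ₀ N (Φ N)) Φ ρ u θ 0 →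
    ∀ t ∈ Set.Ico 0 T, (∀ s ∈ Set.Icc 0 t, ∀ x, ρ s x * σ ^ 3 ≤ ηc) →
    let P : (N : ℕ) → MeasureTheory.Measure (Literature.Analysis.FluidPDE.Config (N + 1) (Fin 3) (UnitAddTorus (Fin 3))) := fun N => Literature.MathematicalPhysics.KineticTheory.localGibbsLaw σ a₀ u₀ θ₀ N (Φ N);
    let μ : (N : ℕ) → ℝ → MeasureTheory.Measure ((UnitAddTorus (Fin 3)) × (EuclideanSpace ℝ (Fin 3))) := fun N s => ((N : ENNReal) + 1)⁻¹ • MeasureTheory.Measure.sum (fun i : Fin (N + 1) => ((Φ N).lawAt (P N) s).map (fun z => z i));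
    let idx : ℕ → (UnitAddTorus (Fin 3)) → (Fin 3 → ℕ) := fun m x i => ⌊(m : ℝ) * Literature.Analysis.FunctionSpaces.Torus.repr x i⌋₊;
    let μB : ℕ → ℝ → ℕ → (Fin 3 → ℕ) → MeasureTheory.Measure (EuclideanSpace ℝ (Fin 3)) := fun N s m k => ((μ N s).restrict ({x : (UnitAddTorus (Fin 3)) | idx m x = k} ×ˢ (Set.univ : Set (EuclideanSpace ℝ (Fin 3))))).snd;
    let mass : ℕ → ℝ → ℕ → (Fin 3 → ℕ) → ℝ := fun N s m k => ((μB N s m k) Set.univ).toReal;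
    let vel : ℕ → ℝ → ℕ → (Fin 3 → ℕ) → (EuclideanSpace ℝ (Fin 3)) := fun N s m k => (mass N s m k)⁻¹ • ∫ v, v ∂(μB N s m k);
    let temp : ℕ → ℝ → ℕ → (Fin 3 → ℕ) → ℝ := fun N s m k => (3 * mass N s m k)⁻¹ * ∫ v, ‖v - vel N s m k‖ ^ 2 ∂(μB N s m k);
    let ent : ℝ → ℝ → ℝ := fun r ϑ => 3 / 2 * Real.log ϑ - Real.log r - Literature.MathematicalPhysics.KineticTheory.hsExcessFreeEnergy (r * σ ^ 3);
    let Sblk : ℕ → ℝ → ℕ → ℝ := fun N s m => ∑ k ∈ Fintype.piFinset (fun _ : Fin 3 => Finset.range m), mass N s m k * ent ((m : ℝ) ^ 3 * mass N s m k) (temp N s m k);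
    ∀ δ : ℝ, 0 < δ → ∃ m₀ : ℕ, ∀ m : ℕ, m₀ ≤ m →
      ∀ᶠ N : ℕ in Filter.atTop, ∀ s ∈ Set.Icc 0 t, (∫ x, ρ s x * ent (ρ s x) (θ s x)) - δ ≤ Sblk N s m

/-- **EntropicWeakStrongL1** — Dafermos' relative-entropy stability for hard-sphere Euler in a-priori form
(global entropy inequality only), with the weak-form residual `W` assumed small AT the evaluation time `s`
and in `L¹(0, s)` only: same data as `EntropicWeakStrongHS` (`θo, h, Ucl, lam, flux, pair, W, dist2` verbatim),
conclusion `∀ s ∈ [0,t], |W s| ≤ δ → ∫₀ˢ |W| ≤ δ → dist2 s ≤ ε`. Gronwall with forcing. -/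
def EntropicWeakStrongL1 : Prop :=
  HsEosLowDensity → ∃ η₀ : ℝ, 0 < η₀ ∧ ∀ σ : ℝ, 0 < σ → ∀ (T : ℝ) (ρ θ : ℝ → (UnitAddTorus (Fin 3)) → ℝ) (u : ℝ →
    (UnitAddTorus (Fin 3)) →
    (EuclideanSpace ℝ (Fin 3))), Literature.MathematicalPhysics.KineticTheory.IsHardSphereEulerSolution σ T ρ u θ →
    (∀ s ∈ Set.Ico 0 T, ∀ x, ρ s x * σ ^ 3 < η₀) →
    ∀ t ∈ Set.Ico 0 T, ∀ K : Set (ℝ × (EuclideanSpace ℝ (Fin 3)) × ℝ), IsCompact K →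
    K ⊆ {U : ℝ × (EuclideanSpace ℝ (Fin 3)) × ℝ | 0 < U.1 ∧ U.1 * σ ^ 3 < η₀ ∧ ‖U.2.1‖ ^ 2 < 2 * U.1 * U.2.2} →
    ∀ ε : ℝ, 0 < ε → ∃ δ : ℝ, 0 < δ ∧ ∀ V : ℝ → (UnitAddTorus (Fin 3)) →
    ℝ × (EuclideanSpace ℝ (Fin 3)) × ℝ, Measurable (Function.uncurry V) → (∀ s x, V s x ∈ K) →
    let θo : ℝ × (EuclideanSpace ℝ (Fin 3)) × ℝ → ℝ := fun U => 2 / 3 * (U.2.2 / U.1 - ‖U.2.1‖ ^ 2 / (2 * U.1 ^ 2));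
    let h : ℝ × (EuclideanSpace ℝ (Fin 3)) × ℝ → ℝ := fun U => -(U.1 * (3 / 2 * Real.log (θo U) - Real.log U.1 - Literature.MathematicalPhysics.KineticTheory.hsExcessFreeEnergy (U.1 * σ ^ 3)));
    let Ucl : ℝ → (UnitAddTorus (Fin 3)) → ℝ × (EuclideanSpace ℝ (Fin 3)) × ℝ := fun s x => (ρ s x, ρ s x • u s x, Literature.MathematicalPhysics.KineticTheory.totalEnergyDensity (ρ s x) (u s x) (θ s x));
    let lam : ℝ → (UnitAddTorus (Fin 3)) → ℝ × (EuclideanSpace ℝ (Fin 3)) × ℝ := fun s x => (-(3 / 2 * Real.log (θ s x) - Real.log (ρ s x) - Literature.MathematicalPhysics.KineticTheory.hsExcessFreeEnergy (ρ s x * σ ^ 3)) + 5 / 2 - ‖u s x‖ ^ 2 / (2 * θ s x) + ρ s x * σ ^ 3 * deriv Literature.MathematicalPhysics.KineticTheory.hsExcessFreeEnergy (ρ s x * σ ^ 3), (θ s x)⁻¹ • u s x, -(θ s x)⁻¹);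
    let flux : Fin 3 → ℝ × (EuclideanSpace ℝ (Fin 3)) × ℝ → ℝ × (EuclideanSpace ℝ (Fin 3)) × ℝ := fun i U => (U.2.1 i, (U.2.1 i / U.1) • U.2.1 + Literature.MathematicalPhysics.KineticTheory.hsPressure σ U.1 (θo U) • EuclideanSpace.single i (1 : ℝ), (U.2.2 + Literature.MathematicalPhysics.KineticTheory.hsPressure σ U.1 (θo U)) * U.2.1 i / U.1);
    let pair : (ℝ × (EuclideanSpace ℝ (Fin 3)) × ℝ) → (ℝ × (EuclideanSpace ℝ (Fin 3)) × ℝ) → ℝ := fun L U => L.1 * U.1 + (∑ j : Fin 3, L.2.1 j * U.2.1 j) + L.2.2 * U.2.2;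
    let W : ℝ → ℝ := fun s => (∫ x, pair (lam s x) (V s x)) - (∫ x, pair (lam 0 x) (V 0 x)) - ∫ τ in (0 : ℝ)..s, ∫ x, (pair (Literature.Analysis.FunctionSpaces.Torus.timeDerivWithin (Set.Ico 0 T) lam τ x) (V τ x) + ∑ i : Fin 3, pair (Literature.Analysis.FunctionSpaces.Torus.partialDeriv i (lam τ) x) (flux i (V τ x)));
    let dist2 : ℝ → ℝ := fun s => ∫ x, ((V s x).1 - (Ucl s x).1) ^ 2 + ‖(V s x).2.1 - (Ucl s x).2.1‖ ^ 2 + ((V s x).2.2 - (Ucl s x).2.2) ^ 2;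
    (∀ s ∈ Set.Icc 0 t, ∫ x, h (V s x) ≤ (∫ x, h (Ucl 0 x)) + δ) → dist2 0 ≤ δ → ∀ s ∈ Set.Icc 0 t, |W s| ≤ δ →
      (∫ τ in (0 : ℝ)..s, |W τ|) ≤ δ → dist2 s ≤ ε

/-! ## §1 The stubs (sorries live ONLY here) -/

/-- **S0 — the squeeze with the matched reference retained** (M; re-assembly of the landed parts I–VIII of
`SqueezeToBlockGibbs` with the explicit witness of `JaynesSqueezeSqueeze.blockGibbs_core`). -/
theorem stub_matchedSqueeze :
    NoMeanEntropyProduction → MeanBlocksInRange → DiluteSelfConsistency → MatchedBlockGibbs := by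
  sorry

/-- **S1 — kinetic closure from block local Gibbsianity** (M–L; entropy inequality + exponential
concentration of one-body block observables under the dilute block-constant reference + K4). -/
theorem stub_kineticClosure :
    MatchedBlockGibbs → EnergyCurrentTails → MeanBlocksInRange → DiluteSelfConsistency → KineticClosure := by
  sorry

/-- **S2 — the Clausius direction** (M; `KL ≥ 0` in the bookkeeping identity at the matched reference,
uniform LDA from R, time-zero identification, entropy conservation). -/
theorem stub_blockClausius : MeanBlocksInRange → DiluteSelfConsistency → BlockClausius := by
  sorry

/-- **S3 — Dafermos' stability with pointwise + `L¹`-in-time residual** (M–L; the computation of the landed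
`Theorems.EntropicWeakStrong.*` closed by Gronwall with forcing). -/
theorem stub_entropicWeakStrongL1 : EntropicWeakStrongL1 := by
  sorry

/-- **S4 — the synthesis** (L, hardest): block mean fields as Dafermos comparison field, frozen-test-function
weak form on finite time grids, K2 at grid endpoints and pointwise inside time integrals (dominated
convergence), S3 at each fixed time, diagonal `m → ∞`. -/
theorem stub_meanFieldsSynthesis :
    KineticClosure → BlockClausius → CollisionalFluxLocality → EnergyCurrentTails → MeanBlocksInRange →
      DiluteSelfConsistency → BlockGibbs → EntropicWeakStrongL1 → MeanFieldsConverge := by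
  sorry

/-! ## §2 The composition (sorry-free) -/

/-- **The crux from the five stubs.** `SqueezeClosure` BY NAME: the matched squeeze (S0) feeds the kinetic
closure (S1); the Clausius bound (S2), K2, K4, R, D, the PROVED waypoint `BlockGibbs`
(`squeezeToBlockGibbs_proof` with the proved statics) and the `L¹`-residual stability (S3) feed the synthesis
(S4), whose output `MeanFieldsConverge` closes the item through the landed
`JaynesSqueezeClosure.blockGibbsToRelEntropy_of_meanFieldsConverge` and the proved statics. -/
theorem SqueezeClosure_of :
    (NoMeanEntropyProduction → MeanBlocksInRange → DiluteSelfConsistency → MatchedBlockGibbs) →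
    (MatchedBlockGibbs → EnergyCurrentTails → MeanBlocksInRange → DiluteSelfConsistency → KineticClosure) →
    (MeanBlocksInRange → DiluteSelfConsistency → BlockClausius) →
    EntropicWeakStrongL1 →
    (KineticClosure → BlockClausius → CollisionalFluxLocality → EnergyCurrentTails → MeanBlocksInRange →
      DiluteSelfConsistency → BlockGibbs → EntropicWeakStrongL1 → MeanFieldsConverge) →
    Summit.AtomisticToContinuum.HydrodynamicLimit.Theses.JaynesSqueeze.SqueezeClosure := by
  intro hS0 hS1 hS2 hS3 hS4 h₁ h₂ h₃ h₄ h₅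
  have hEos : HsEosLowDensity := HsEosLowDensity_holds
  have hLDA : HardSphereLDA := Summit.AtomisticToContinuum.HydrodynamicLimit.Theorems.hardSphereLDA_proof
  have hLGC : LocalGibbsConcentrationDilute :=
    Summit.AtomisticToContinuum.HydrodynamicLimit.Theorems.localGibbsConcentrationDilute_proof
  have hEWS : EntropicWeakStrongHS :=
    Summit.AtomisticToContinuum.HydrodynamicLimit.Theorems.EntropicWeakStrong.entropicWeakStrongHS_proof
  have hBG : BlockGibbs :=
    Summit.AtomisticToContinuum.HydrodynamicLimit.Theorems.JaynesSqueezeSqueeze.squeezeToBlockGibbs_proof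
      h₁ h₄ hLDA hEos h₅
  have hMBG : MatchedBlockGibbs := hS0 h₁ h₄ h₅
  have hKC : KineticClosure := hS1 hMBG h₃ h₄ h₅
  have hCl : BlockClausius := hS2 h₄ h₅
  have hMFC : MeanFieldsConverge := hS4 hKC hCl h₂ h₃ h₄ h₅ hBG hS3
  exact Summit.AtomisticToContinuum.HydrodynamicLimit.Theorems.JaynesSqueezeClosure.blockGibbsToRelEntropy_of_meanFieldsConverge
    hMFC hBG h₂ h₃ h₄ hEWS hLDA hLGC hEos h₅

/-- The same composition with the registered stubs plugged in (the crux modulo the five `sorry`s). -/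
theorem SqueezeClosure_skeleton : Summit.AtomisticToContinuum.HydrodynamicLimit.Theses.JaynesSqueeze.SqueezeClosure :=
  SqueezeClosure_of stub_matchedSqueeze stub_kineticClosure stub_blockClausius stub_entropicWeakStrongL1
    stub_meanFieldsSynthesis

end Summit.AtomisticToContinuum.HydrodynamicLimit.Cruxes.SqueezeClosure.Birth

end
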